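import Summits.QuantumFields.YangMills.Theorems.BalabanUVNodesN09MembershipNestingKernel

/-!
# NODE N09 — door v1.3 (F-I-χ «ρ-edition»), KERNEL 2: HERED, (N29) and the NESTING binder over a GENERIC (1.1)-domain family `dom` — this seat's g2 FILE 4
# (`…N09HeredModFineOfThm1`) and FILE 5 §2 (`…N09NestingOfHierAxial`) RE-TYPED with `domAltOfRecord θ.ν K k ↦ dom k`, and the nesting binder's second half re-targeted from the
# plaquette set `domAlt_{i+1}` to a MEMBERSHIP family (KERNEL 1's `iterUk_succ_mem_dom_of_memChar`), the (F7a) support clause in its membership form ([I] p. 265)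

TRACK A (YM-PLAN §2d, node N09 of 28), seat `pub-ymgap-dag-n09-w1` (D-0149 width seat 1∕4), generation g8 — director-ym №313 (R3) «(G-a) GO IN FULL: dom-generic twins T4∕TN».  Key of record K1⁹
stmt-QuantumFields-27364 (`--supports … --as helper`, count-neutral).  [I] = [Balaban1987RG1] (CMP 109), [B11] = [Balaban1985Variational] (CMP 102), [B7] = [Balaban1985Averaging] (CMP 98),
[6] = [Balaban1985RegularSpaces].  Imports KERNEL 1 `…N09MembershipNestingKernel` (⇒ g2 FILES 1–2, 4–5, n09-w2 g2 `…N09AxialCovariance181`, dag-n09-w3 `…FluctNesting`, dag-n21-c (53)).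
THEOREMS ONLY (0 `def`, 0 `sorry`).

WHY.  g2's FILE 4 and FILE 5 §2 carry `domAltOfRecord F N ν K k` HARD-WIRED in their binder types although their proofs never read the domain (it is the index set of a `∀`; dag-n09-w3's
underlying chain `…FluctNesting.chiβ13_iterUk_eq_one_of_critCfg_hered` ∕ `iterUk_mem_regSet_of_supp_of_critCfg_hered` is already `dom`-generic).  Door v1.3 keys the rows on the membership
family `domU^ρ`; so THIS FILE re-types (not re-proves) them over an arbitrary `dom : (k : ℕ) → Set _`:
* §1 `orbitRel_Uk_UkSucc_iter_of_thm1_εbg_of_reg8_on` (mixed-radii `HOrbit`), `hered_mod_fine_…_on`, `hered_of_axial_…_on`, ★ `hher_of_hierAxial_of_thm1_εbg_of_reg8_on` (HERED from the [B11]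
  rows `hres`∕`huniq` at `εbg`, the (8)-row at `ν.εreg`, `0 ≤ εreg ≤ εbg`, the two axialities), `haxcrit_of_hax_solvable_on` — FILE 4 §1–§3 verbatim over `dom`.
* §2 `chiβ13_iterUk_eq_one_of_hierAxial_of_reg8_on` ((N29)), `iterUk_mem_regSet_of_supp_of_hierAxial_of_reg8_on` — FILE 4 §4 over `dom`.
* §3 ★★★ `hnestU_of_suppU_of_hierAxial_of_memChar` — THE NESTING BINDER OF FILE 5's ENGINE FOR A MEMBERSHIP FAMILY: for `dom` characterised by the four conjuncts (`hdom`), `V ∈ dom k`,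
  `i + 1 < k ≤ P.K` ⇒ `Ū^{i+1}(U_k V) ∈ regSetOfRecord P.K i ρ_i ∩ dom (i+1)`, from: the MEMBERSHIP form of the pointwise support clause (F7a)
  `hχregU : ∀ i, i+1 < K → ∀ U, Ū ∈ dom (i+2) → U ∉ regSet_i ∩ dom (i+1) → χ^{(2.9)}_{i+1}(U) = 0` ([I] p. 265 «we define χ_k in such a way that the domain of integration is restricted to
  configurations V for which U_k(V) ∈ 𝔘_k(ε₀)»; K0e's analytic debt in membership form, DISPLAYED), `0 < θ₀.ε₂₉`, [B11]'s `hres`∕`huniq` over `dom` (N07, DISPLAYED), the letters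
  `0 < ρ ≤ θ₀.ν.εreg ≤ εbg`, the hierarchical axiality `haxbg` and the on-`dom` axiality `haxDom` (conventions), the [B7]-numerics ON `ρ` and `2ρ ≤ ν.ε₀·L²`.  The (8)-row and `h11` are NOT
  hypotheses (conjuncts of `dom`); the `dom (i+1)` half is KERNEL 1 (no plaquette threshold), the `regSet_i` half is (N29) + `hχregU` exactly as in g2's FILE 5 §2.
HONEST FRAMING: count-neutral kernel gauge∕order bookkeeping BY NAME; NOTHING of Bałaban's asserted ([B11]'s rows, (F7a) in membership form, the axiality conventions are DISPLAYED
hypotheses); NO carrier re-pointed; no record core edited ((D1′) deferred, №313 (R4)); HERED NOT claimed at the bare-choice record; N09 ∕ N07 NOT discharged; K0⁷ ∕ K1⁹ ∕ K3⁸ NOT closed; counts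
unmoved (typed 28∕28 · discharged 8∕28); one finite four-torus programme at fixed ε — R4 closes the conditional rung `BalabanLadder.UV` only; the Yang–Mills mass gap (Clay) is NOT proved by
any of this; nothing continuum ∕ ℝ⁴ ∕ OS.  THEOREMS ONLY, standard axioms.
-/

noncomputable section

namespace Summit.QuantumFields.YangMills.BalabanUVNodes.N09HeredNestingOnMembershipFamily

open Literature.MathematicalPhysics.QuantumFieldTheory.Balaban1983to89
open Literature.MathematicalPhysics.QuantumFieldTheory.Balaban1983to89.T4Continuum (T4Family)
open Literature.MathematicalPhysics.QuantumFieldTheory.Balaban1983to89.Node00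
open Literature.MathematicalPhysics.QuantumFieldTheory.Balaban1983to89.ExpMeanLog (deltaSU)
open Literature.MathematicalPhysics.QuantumFieldTheory.Balaban1983to89.B12GaugeOrbits021 (OrbitRel IsResidual)
open Literature.MathematicalPhysics.QuantumFieldTheory.Balaban1983to89.B16Sect1Backgrounds (toMS iter_gaugeAct)
open Literature.MathematicalPhysics.QuantumFieldTheory.Balaban1983to89.GaugeField (gaugeAct)
open Summit.QuantumFields.YangMills.BalabanUVNodes.N09BackgroundRadiiTransfer
open Summit.QuantumFields.YangMills.BalabanUVNodes.N09BackgroundRadiiTransferRestrict (bgReg_anti_level succ_le_range_of_le_of_lt)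
open Summit.QuantumFields.YangMills.BalabanUVNodes.N09AxialCovariance181 (gaugeAct_eq_self_of_fine_of_axialGauge)
open Summit.QuantumFields.YangMills.BalabanUVNodes.N09AtRecord13SepCoPHFluctNesting (iterUk_mem_regSet_of_supp_of_critCfg_hered chiβ13_iterUk_eq_one_of_critCfg_hered)
open Summit.QuantumFields.YangMills.BalabanUVNodes.N09MembershipNestingKernel (iterUk_mem_dom_of_memChar iterUk_succ_mem_dom_of_memChar haxcrit_of_haxDom_of_memChar)

variable {F : T4Family} {N : ℕ} [NeZero N]

/-! ## §1. FILE 4 §1–§3 over a generic domain family: mixed-radii `HOrbit`, HERED modulo a fine transformation, HERED from axiality -/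

/-- ★ **MIXED-RADII `HOrbit` OVER A GENERIC DOMAIN FAMILY** (g2 FILE 4 §1 with `domAltOfRecord ↦ dom`): for `V ∈ dom k`, `j < k ≤ K`, the level-`(j+1)` minimiser of record at the
cut-off's radius `ν.εreg` over `Ū^{j+1}(U_k^{(εbg)} V)` lies in the residual orbit of `U_k^{(εbg)} V` — from `hres`, `huniq` at `εbg`, the (8)-row at `ν.εreg`, `0 ≤ εreg ≤ εbg`.
[cite: Balaban1985Variational, Thm 1 (6) and (8) p.279; Balaban1987RG1, (1.1)–(1.2) p.260 and (2.3) p.265] -/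
theorem orbitRel_Uk_UkSucc_iter_of_thm1_εbg_of_reg8_on (ν : Stage7Numerics) (εbg : ℝ) (K : ℕ) {dom : (k : ℕ) → Set (GaugeField (F.P K) k (SU N))}
    (hres : ∀ k, k ≤ K → HRestrict F N εbg K k (dom k))
    (huniq : ∀ k, k ≤ K → ∀ V ∈ dom k, ∀ j < k,
      UniqueUkOrbit F N K (j + 1) εbg (Averaging.iter (avOfRecord F N K) (j + 1) (Uk F N K k εbg V)))
    (hreg8 : ∀ k, k ≤ K → ∀ V ∈ dom k, Uk F N K k εbg V ∈ bgReg F N K k ν.εreg) (hle : ν.εreg ≤ εbg) (hεreg : 0 ≤ ν.εreg) :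
    ∀ k, k ≤ K → ∀ V ∈ dom k, ∀ j < k,
      OrbitRel (j + 1) (Uk F N K k εbg V)
        (Uk F N K (j + 1) ν.εreg (Averaging.iter (avOfRecord F N K) (j + 1) (Uk F N K k εbg V))) := by
  intro k hk V hV j hj
  have hB := hres k hk V hV j hj
  have hmem : Uk F N K k εbg V ∈ bgReg F N K (j + 1) ν.εreg := bgReg_anti_level (by omega) hεreg (hreg8 k hk V hV)
  have hBε := isBackground_of_le_of_mem hle hB hmem
  exact uniqueUkOrbit_of_le_of_isBackground_mem hle hB hmem (huniq k hk V hV j hj) _ _ hBε (isBackground_Uk ⟨_, hBε⟩)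



/-- ★★ **HERED MODULO A FINE TRANSFORMATION**: for `V ∈ domAlt_k`, `j < k ≤ K`, the critical configuration of record over the background's `(j+1)`-average is the background's
`j`-average UP TO a level-`j` gauge transformation `s` trivial at the block centres: `critCfgOfRecord ν K j (Ū^{j+1}(U_k V)) = (Ū^j(U_k V))^s`, `s (emb y) = 1` (`s = r↾T^{(j)}` for the
residual `r` of §1, by `M^j(U^r) = (M^j U)^{r↾T^{(j)}}`).  This is the EXACT content the bare-choice record gives; `s = 1` is what HERED asks.
[cite: Balaban1987RG1, (2.3) p.265 and (1.1) p.260; Balaban1985Variational, Thm 1 (6) p.279; Balaban1985Averaging, (11) p.19] -/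
theorem hered_mod_fine_of_thm1_εbg_of_reg8_on (ν : Stage7Numerics) (εbg : ℝ) (K : ℕ) {dom : (k : ℕ) → Set (GaugeField (F.P K) k (SU N))}
    (hres : ∀ k, k ≤ K → HRestrict F N εbg K k (dom k))
    (huniq : ∀ k, k ≤ K → ∀ V ∈ dom k, ∀ j < k,
      UniqueUkOrbit F N K (j + 1) εbg (Averaging.iter (avOfRecord F N K) (j + 1) (Uk F N K k εbg V)))
    (hreg8 : ∀ k, k ≤ K → ∀ V ∈ dom k, Uk F N K k εbg V ∈ bgReg F N K k ν.εreg) (hle : ν.εreg ≤ εbg) (hεreg : 0 ≤ ν.εreg) :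
    ∀ k, k ≤ K → ∀ V ∈ dom k, ∀ j < k, ∃ s : GaugeTransf (F.P K) j (SU N), (∀ y : Site (F.P K) (j + 1), s (emb y) = 1) ∧
      critCfgOfRecord F N ν K j (Averaging.iter (avOfRecord F N K) (j + 1) (Uk F N K k εbg V)) =
        gaugeAct s (Averaging.iter (avOfRecord F N K) j (Uk F N K k εbg V)) := by
  intro k hk V hV j hj
  obtain ⟨r, hr, hEq⟩ := orbitRel_Uk_UkSucc_iter_of_thm1_εbg_of_reg8_on ν εbg K hres huniq hreg8 hle hεreg k hk V hV j hj
  have hj' : j ≤ (F.P K).m + (F.P K).K := (Nat.le_succ j).trans (succ_le_range_of_le_of_lt (F := F) hk hj)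
  refine ⟨toMS r j, fun y => hr y, ?_⟩
  rw [critCfgOfRecord_def, hEq, iter_gaugeAct (avOfRecord F N K) r _ j hj']



/-- ★★ **HERED FROM AXIALITY OF BOTH SIDES**: if, for a contour system `cd` at level `j`, both the background's `j`-average `Ū^j(U_k V)` and the critical configuration of record over
`Ū^{j+1}(U_k V)` are in the block axial gauge `AxialGauge cd`, then they are EQUAL — §2's fine `s` relates two axial configurations, so it is `1` (n09-w2 g2's
`gaugeAct_eq_self_of_fine_of_axialGauge`). [cite: Balaban1987RG1, (2.2)–(2.3) p.265; Balaban1985RegularSpaces, (1.15) p.78; Balaban1985Variational, Thm 1 (6) p.279] -/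
theorem hered_of_axial_of_thm1_εbg_of_reg8_on (ν : Stage7Numerics) (εbg : ℝ) (K : ℕ) {dom : (k : ℕ) → Set (GaugeField (F.P K) k (SU N))}
    (hres : ∀ k, k ≤ K → HRestrict F N εbg K k (dom k))
    (huniq : ∀ k, k ≤ K → ∀ V ∈ dom k, ∀ j < k,
      UniqueUkOrbit F N K (j + 1) εbg (Averaging.iter (avOfRecord F N K) (j + 1) (Uk F N K k εbg V)))
    (hreg8 : ∀ k, k ≤ K → ∀ V ∈ dom k, Uk F N K k εbg V ∈ bgReg F N K k ν.εreg) (hle : ν.εreg ≤ εbg) (hεreg : 0 ≤ ν.εreg)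
    {k : ℕ} (hk : k ≤ K) {V : GaugeField (F.P K) k (SU N)} (hV : V ∈ dom k) {j : ℕ} (hj : j < k) (cd : ContourData (F.P K) j (SU N))
    (haxbg : AxialGauge cd (Averaging.iter (avOfRecord F N K) j (Uk F N K k εbg V)))
    (haxcrit : AxialGauge cd (critCfgOfRecord F N ν K j (Averaging.iter (avOfRecord F N K) (j + 1) (Uk F N K k εbg V)))) :
    critCfgOfRecord F N ν K j (Averaging.iter (avOfRecord F N K) (j + 1) (Uk F N K k εbg V)) = Averaging.iter (avOfRecord F N K) j (Uk F N K k εbg V) := by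
  obtain ⟨s, hs, hEq⟩ := hered_mod_fine_of_thm1_εbg_of_reg8_on ν εbg K hres huniq hreg8 hle hεreg k hk V hV j hj
  rw [hEq] at haxcrit ⊢
  exact gaugeAct_eq_self_of_fine_of_axialGauge cd haxbg hs haxcrit

/-- ★★★ **dag-n09-w3's BINDER `hher` VERBATIM** (`…FluctNesting.chiβ13_iterUk_eq_one_of_critCfg_hered` ∕ `…_of_regSets_of_critCfg_hered`, generic `dom`, `ε := εbg`)
**FROM THE [B11] ×3 PACKAGE AT `εbg`, THE (8)-MEMBERSHIP CLAUSE, `0 ≤ εreg ≤ εbg`, AND HIERARCHICAL AXIALITY**: if for contour systems `cd j` (e.g. node00-def-B's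
`contourOfRecord F N K j`) every partial average `Ū^j(U_k V)` of the background of a small field is `cd j`-axial (the background is chosen in the HIERARCHICAL axial gauge — def-R∕def-T's
re-point) and the record's critical configuration is `cd j`-axial over those averages (n09-w2 g2's convention `hax` on the solvable set), then HERED holds.  CONDITIONAL on every displayed
hypothesis; at the bare-choice record the two axialities FAIL by design (located, not a defect of print). [cite: Balaban1987RG1, (2.3) p.265, (1.1)–(1.2) p.260; Balaban1985Variational, Thm 1 (6) and (8) p.279; Balaban1985RegularSpaces, (1.15) p.78] -/
theorem hher_of_hierAxial_of_thm1_εbg_of_reg8_on (ν : Stage7Numerics) (εbg : ℝ) (K : ℕ) {dom : (k : ℕ) → Set (GaugeField (F.P K) k (SU N))} (cd : (j : ℕ) → ContourData (F.P K) j (SU N))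
    (hres : ∀ k, k ≤ K → HRestrict F N εbg K k (dom k))
    (huniq : ∀ k, k ≤ K → ∀ V ∈ dom k, ∀ j < k,
      UniqueUkOrbit F N K (j + 1) εbg (Averaging.iter (avOfRecord F N K) (j + 1) (Uk F N K k εbg V)))
    (hreg8 : ∀ k, k ≤ K → ∀ V ∈ dom k, Uk F N K k εbg V ∈ bgReg F N K k ν.εreg) (hle : ν.εreg ≤ εbg) (hεreg : 0 ≤ ν.εreg)
    (haxbg : ∀ k, k ≤ K → ∀ V ∈ dom k, ∀ j < k, AxialGauge (cd j) (Averaging.iter (avOfRecord F N K) j (Uk F N K k εbg V)))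
    (haxcrit : ∀ k, k ≤ K → ∀ V ∈ dom k, ∀ j < k,
      AxialGauge (cd j) (critCfgOfRecord F N ν K j (Averaging.iter (avOfRecord F N K) (j + 1) (Uk F N K k εbg V)))) :
    ∀ k, k ≤ K → ∀ V ∈ dom k, ∀ j < k,
      critCfgOfRecord F N ν K j (Averaging.iter (avOfRecord F N K) (j + 1) (Uk F N K k εbg V)) = Averaging.iter (avOfRecord F N K) j (Uk F N K k εbg V) :=
  fun k hk V hV j hj => hered_of_axial_of_thm1_εbg_of_reg8_on ν εbg K hres huniq hreg8 hle hεreg hk hV hj (cd j) (haxbg k hk V hV j hj) (haxcrit k hk V hV j hj)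

/-- **THE `haxcrit` INPUT IS n09-w2 g2's `hax` RESTRICTED**: axiality of the record's critical configuration «on the solvable set at radius `εreg`» (the shape of
`…N09AxialCovariance181.thm3Member_stage13SepCoPH_of_stepsOnLoc_of_axialOn`'s `hax`) gives it over the averages `Ū^{j+1}(U_k V)` of small fields, which ARE solvable at `εreg`
(§1's witness). [cite: Balaban1987RG1, (2.3) p.265 (bookkeeping)] -/
theorem haxcrit_of_hax_solvable_on (ν : Stage7Numerics) (εbg : ℝ) (K : ℕ) {dom : (k : ℕ) → Set (GaugeField (F.P K) k (SU N))} (cd : (j : ℕ) → ContourData (F.P K) j (SU N))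
    (hres : ∀ k, k ≤ K → HRestrict F N εbg K k (dom k))
    (hreg8 : ∀ k, k ≤ K → ∀ V ∈ dom k, Uk F N K k εbg V ∈ bgReg F N K k ν.εreg) (hle : ν.εreg ≤ εbg) (hεreg : 0 ≤ ν.εreg)
    (hax : ∀ j < K, ∀ W : GaugeField (F.P K) (j + 1) (SU N), UkExists F N K (j + 1) ν.εreg W → AxialGauge (cd j) (critCfgOfRecord F N ν K j W)) :
    ∀ k, k ≤ K → ∀ V ∈ dom k, ∀ j < k,
      AxialGauge (cd j) (critCfgOfRecord F N ν K j (Averaging.iter (avOfRecord F N K) (j + 1) (Uk F N K k εbg V))) := by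
  intro k hk V hV j hj
  refine hax j (by omega) _ ⟨Uk F N K k εbg V, ?_⟩
  exact isBackground_of_le_of_mem hle (hres k hk V hV j hj) (bgReg_anti_level (by omega) hεreg (hreg8 k hk V hV))


/-! ## §2. FILE 4 §4 over a generic domain family: (N29) and the regular-set half of the nesting binder -/

/-- **(N29) FROM HIERARCHICAL AXIALITY**: under §3's inputs (at a Stage-13 parameter `θ₀`, radius letters `θ₀.ν.εreg ≤ εbg`) and `0 < θ₀.ε₂₉`, the β-slot cut-off is `1` at every
partial average of the background of a small field: `χ^{(2.9)}_j(Ū^j(U_k V)) = 1` (dag-n09-w3's `chiβ13_iterUk_eq_one_of_critCfg_hered` fed by `hher_of_hierAxial_of_thm1_εbg_of_reg8_on`).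
[cite: Balaban1987RG1, (2.3) p.265 and (2.9) p.266; Balaban1985Variational, Thm 1 (6) and (8) p.279] -/
theorem chiβ13_iterUk_eq_one_of_hierAxial_of_reg8_on (θ₀ : Stage13Params F N) (hε : 0 < θ₀.ε₂₉) (P : B12.RunParams) (εbg : ℝ) {dom : (k : ℕ) → Set (GaugeField (F.P P.K) k (SU N))}
    (cd : (j : ℕ) → ContourData (F.P P.K) j (SU N))
    (hres : ∀ k, k ≤ P.K → HRestrict F N εbg P.K k (dom k))
    (huniq : ∀ k, k ≤ P.K → ∀ V ∈ dom k, ∀ j < k,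
      UniqueUkOrbit F N P.K (j + 1) εbg (Averaging.iter (avOfRecord F N P.K) (j + 1) (Uk F N P.K k εbg V)))
    (hreg8 : ∀ k, k ≤ P.K → ∀ V ∈ dom k, Uk F N P.K k εbg V ∈ bgReg F N P.K k θ₀.ν.εreg) (hle : θ₀.ν.εreg ≤ εbg) (hεreg : 0 ≤ θ₀.ν.εreg)
    (haxbg : ∀ k, k ≤ P.K → ∀ V ∈ dom k, ∀ j < k, AxialGauge (cd j) (Averaging.iter (avOfRecord F N P.K) j (Uk F N P.K k εbg V)))
    (haxcrit : ∀ k, k ≤ P.K → ∀ V ∈ dom k, ∀ j < k,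
      AxialGauge (cd j) (critCfgOfRecord F N θ₀.ν P.K j (Averaging.iter (avOfRecord F N P.K) (j + 1) (Uk F N P.K k εbg V)))) :
    ∀ k, k ≤ P.K → ∀ V ∈ dom k, ∀ j < k,
      chiβOfRecord₁₃ F N θ₀ P.K (gOfRecord₁₃ F N θ₀ P) j (Averaging.iter (avOfRecord F N P.K) j (Uk F N P.K k εbg V)) = 1 :=
  chiβ13_iterUk_eq_one_of_critCfg_hered θ₀ hε P (hher_of_hierAxial_of_thm1_εbg_of_reg8_on θ₀.ν εbg P.K cd hres huniq hreg8 hle hεreg haxbg haxcrit)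

/-- ★★ **THE REGULAR-SET HALF OF N09's NESTING BINDER (F7b) FROM (F7a) + HIERARCHICAL AXIALITY** (dag-n09-w3's `iterUk_mem_regSet_of_supp_of_critCfg_hered` with its `hher` supplied by §3):
under the global support binder (F7a) `hχreg`, `0 < θ₀.ε₂₉`, the [B11] binders `hres ∕ huniq` at `εbg`, the (8)-membership clause, `0 ≤ εreg ≤ εbg` and the two axialities,
`Ū^{i+1}(U_k V) ∈ regSetOfRecord K i ρ_i` for every small field `V ∈ domAlt_k`, `i + 1 < k ≤ P.K` — the `regSet` half of the OnDomains doors' `hnestreg` (the `domAlt_{i+1}` half is the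
averaging-regularity statement «averages of a regular background are small fields», [B7] Prop. 1 — NOT supplied here). [cite: Balaban1987RG1, (2.1)–(2.3) p.265, (2.9)–(2.10) pp.266–267, p.256 l.6; Balaban1985Variational, Thm 1 (6) and (8) p.279] -/
theorem iterUk_mem_regSet_of_supp_of_hierAxial_of_reg8_on (θ₀ : Stage13Params F N) (hε : 0 < θ₀.ε₂₉) (P : B12.RunParams) (εbg : ℝ) {dom : (k : ℕ) → Set (GaugeField (F.P P.K) k (SU N))}
    (cd : (j : ℕ) → ContourData (F.P P.K) j (SU N))
    (hχreg : ∀ i, i + 1 < P.K → ∀ U, U ∉ regSetOfRecord F N P.K i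
        (betaInputOfRecord F N (TβOfRecord₁₃ F N) (chiβOfRecord₁₃ F N θ₀) P.K (gOfRecord₁₃ F N θ₀ P) i) →
      chiβOfRecord₁₃ F N θ₀ P.K (gOfRecord₁₃ F N θ₀ P) (i + 1) U = 0)
    (hres : ∀ k, k ≤ P.K → HRestrict F N εbg P.K k (dom k))
    (huniq : ∀ k, k ≤ P.K → ∀ V ∈ dom k, ∀ j < k,
      UniqueUkOrbit F N P.K (j + 1) εbg (Averaging.iter (avOfRecord F N P.K) (j + 1) (Uk F N P.K k εbg V)))
    (hreg8 : ∀ k, k ≤ P.K → ∀ V ∈ dom k, Uk F N P.K k εbg V ∈ bgReg F N P.K k θ₀.ν.εreg) (hle : θ₀.ν.εreg ≤ εbg) (hεreg : 0 ≤ θ₀.ν.εreg)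
    (haxbg : ∀ k, k ≤ P.K → ∀ V ∈ dom k, ∀ j < k, AxialGauge (cd j) (Averaging.iter (avOfRecord F N P.K) j (Uk F N P.K k εbg V)))
    (haxcrit : ∀ k, k ≤ P.K → ∀ V ∈ dom k, ∀ j < k,
      AxialGauge (cd j) (critCfgOfRecord F N θ₀.ν P.K j (Averaging.iter (avOfRecord F N P.K) (j + 1) (Uk F N P.K k εbg V)))) :
    ∀ k, k ≤ P.K → ∀ V ∈ dom k, ∀ i, i + 1 < k →
      Averaging.iter (avOfRecord F N P.K) (i + 1) (Uk F N P.K k εbg V) ∈ regSetOfRecord F N P.K i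
        (betaInputOfRecord F N (TβOfRecord₁₃ F N) (chiβOfRecord₁₃ F N θ₀) P.K (gOfRecord₁₃ F N θ₀ P) i) :=
  iterUk_mem_regSet_of_supp_of_critCfg_hered θ₀ hε P hχreg (hher_of_hierAxial_of_thm1_εbg_of_reg8_on θ₀.ν εbg P.K cd hres huniq hreg8 hle hεreg haxbg haxcrit)

/-! ## §3. The nesting binder of FILE 5's engine for a MEMBERSHIP family, from the membership form of (F7a) + (N29) + KERNEL 1 -/

/-- ★★★ **THE NESTING BINDER FOR A MEMBERSHIP FAMILY** (`D (i+1) := regSetOfRecord K i ρ_i ∩ dom (i+1)` in FILE 5's engine): for a family `dom` characterised by the four membership conjuncts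
(`hdom`), every positive-level average below the top of the background of a member lies in `regSet_i ∩ dom (i+1)`.  From: the MEMBERSHIP form of the pointwise (F7a) support clause `hχregU`
(K0e's analytic debt, [I] p. 265), `0 < θ₀.ε₂₉`, [B11]'s `hres`∕`huniq` over `dom` at `εbg` (N07), `0 < ρ ≤ θ₀.ν.εreg ≤ εbg`, the hierarchical axiality `haxbg`, the on-`dom` axiality
`haxDom`, the [B7]-numerics on `ρ`, `2ρ ≤ θ₀.ν.ε₀·L²`.  Mechanism = g2's FILE 5 §2 with KERNEL 1 in place of Prop. 2 on the search radius: (N29) at `Ū^{i+1}(U_k V)` (§2; the (8)-row at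
`ν.εreg` is conjunct 4 + `ρ ≤ ν.εreg`), whose next average `Ū^{i+2}(U_k V)` is a MEMBER (KERNEL 1, or `V` itself) — so `hχregU` cannot fire there.  CONDITIONAL on every displayed
hypothesis; nothing of Bałaban asserted. [cite: Balaban1987RG1, (2.1)–(2.3) p.265, (2.9)–(2.10) pp.266–267, (1.1)–(1.2) p.260, p.256 l.6; Balaban1985Variational, Thm 1 (6), (8)–(10) p.279; Balaban1985Averaging, Prop. 2 (53) p.26] -/
theorem hnestU_of_suppU_of_hierAxial_of_memChar (θ₀ : Stage13Params F N) (hεχ : 0 < θ₀.ε₂₉) (P : B12.RunParams) {εbg ρ : ℝ}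
    {dom : (k : ℕ) → Set (GaugeField (F.P P.K) k (SU N))}
    (hdom : ∀ k (V : GaugeField (F.P P.K) k (SU N)), V ∈ dom k ↔
      V ∈ domAltOfRecord F N θ₀.ν P.K k ∧ UkExists F N P.K k εbg V ∧ UniqueUkOrbit F N P.K k εbg V ∧ Uk F N P.K k εbg V ∈ bgReg F N P.K k ρ)
    (cd : (j : ℕ) → ContourData (F.P P.K) j (SU N))
    (hχregU : ∀ i, i + 1 < P.K → ∀ U : GaugeField (F.P P.K) (i + 1) (SU N),
      (avOfRecord F N P.K (i + 1)).avg U ∈ dom (i + 2) →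
        U ∉ regSetOfRecord F N P.K i (betaInputOfRecord F N (TβOfRecord₁₃ F N) (chiβOfRecord₁₃ F N θ₀) P.K (gOfRecord₁₃ F N θ₀ P) i) ∩ dom (i + 1) →
          chiβOfRecord₁₃ F N θ₀ P.K (gOfRecord₁₃ F N θ₀ P) (i + 1) U = 0)
    (hres : ∀ k, k ≤ P.K → HRestrict F N εbg P.K k (dom k))
    (huniq : ∀ k, k ≤ P.K → ∀ V ∈ dom k, ∀ j < k, UniqueUkOrbit F N P.K (j + 1) εbg (Averaging.iter (avOfRecord F N P.K) (j + 1) (Uk F N P.K k εbg V)))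
    (hρ : 0 < ρ) (hρreg : ρ ≤ θ₀.ν.εreg) (hle : θ₀.ν.εreg ≤ εbg)
    (haxbg : ∀ k, k ≤ P.K → ∀ V ∈ dom k, ∀ j < k, AxialGauge (cd j) (Averaging.iter (avOfRecord F N P.K) j (Uk F N P.K k εbg V)))
    (haxDom : ∀ j < P.K, ∀ W ∈ dom (j + 1), AxialGauge (cd j) (critCfgOfRecord F N θ₀.ν P.K j W))
    (hρ3 : (143 * (((((F.P P.K).d + 4 : ℕ) : ℝ)) ^ 2 / 4) ^ 2) * ρ ≤ 1 / 3)
    (hρ2 : 2 * ρ ≤ 2 * deltaSU (Fin N) / ((((F.P P.K).d + 4) * (F.P P.K).L : ℕ) : ℝ) ^ 2) (hρ₀ : 2 * ρ ≤ θ₀.ν.ε₀ * ((F.P P.K).L : ℝ) ^ 2) :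
    ∀ k, k ≤ P.K → ∀ V ∈ dom k, ∀ i, i + 1 < k →
      Averaging.iter (avOfRecord F N P.K) (i + 1) (Uk F N P.K k εbg V) ∈
        regSetOfRecord F N P.K i (betaInputOfRecord F N (TβOfRecord₁₃ F N) (chiβOfRecord₁₃ F N θ₀) P.K (gOfRecord₁₃ F N θ₀ P) i) ∩ dom (i + 1) := by
  have hreg8 : ∀ k, k ≤ P.K → ∀ V ∈ dom k, Uk F N P.K k εbg V ∈ bgReg F N P.K k θ₀.ν.εreg :=
    fun k _ V hV => bgReg_mono hρreg ((hdom k V).1 hV).2.2.2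
  have hεreg : 0 ≤ θ₀.ν.εreg := hρ.le.trans hρreg
  have haxcrit := haxcrit_of_haxDom_of_memChar θ₀.ν cd hdom hres huniq hρ hρ3 hρ2 hρ₀ haxDom
  intro k hk V hV i hi
  have hdomnext : Averaging.iter (avOfRecord F N P.K) (i + 1) (Uk F N P.K k εbg V) ∈ dom (i + 1) :=
    iterUk_succ_mem_dom_of_memChar θ₀.ν hdom hres huniq hρ hρ3 hρ2 hρ₀ k hk V hV i hi
  refine ⟨?_, hdomnext⟩
  have hone := chiβ13_iterUk_eq_one_of_hierAxial_of_reg8_on θ₀ hεχ P εbg cd hres huniq hreg8 hle hεreg haxbg haxcrit k hk V hV (i + 1) hi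
  -- the next average is a member
  have hnext : (avOfRecord F N P.K (i + 1)).avg (Averaging.iter (avOfRecord F N P.K) (i + 1) (Uk F N P.K k εbg V)) ∈ dom (i + 2) :=
    iterUk_mem_dom_of_memChar θ₀.ν hdom hres huniq hρ hρ3 hρ2 hρ₀ k hk V hV (i + 1) hi
  by_contra hn
  exact one_ne_zero (hone ▸ hχregU i (lt_of_lt_of_le hi hk) _ hnext (fun h => hn h.1))

/-- The engine's `hnest` shape (`D 0 := univ`, `D (i+1) := regSet_i ∩ dom (i+1)`; `∀ j < k, Ū^j(U_k V) ∈ D j`) from §3. [cite: Balaban1987RG1, (2.1) p.265 and (1.2) p.260 (bookkeeping)] -/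
theorem hnestD_of_suppU_of_hierAxial_of_memChar (θ₀ : Stage13Params F N) (hεχ : 0 < θ₀.ε₂₉) (P : B12.RunParams) {εbg ρ : ℝ}
    {dom : (k : ℕ) → Set (GaugeField (F.P P.K) k (SU N))}
    (hdom : ∀ k (V : GaugeField (F.P P.K) k (SU N)), V ∈ dom k ↔
      V ∈ domAltOfRecord F N θ₀.ν P.K k ∧ UkExists F N P.K k εbg V ∧ UniqueUkOrbit F N P.K k εbg V ∧ Uk F N P.K k εbg V ∈ bgReg F N P.K k ρ)
    (cd : (j : ℕ) → ContourData (F.P P.K) j (SU N))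
    (hχregU : ∀ i, i + 1 < P.K → ∀ U : GaugeField (F.P P.K) (i + 1) (SU N),
      (avOfRecord F N P.K (i + 1)).avg U ∈ dom (i + 2) →
        U ∉ regSetOfRecord F N P.K i (betaInputOfRecord F N (TβOfRecord₁₃ F N) (chiβOfRecord₁₃ F N θ₀) P.K (gOfRecord₁₃ F N θ₀ P) i) ∩ dom (i + 1) →
          chiβOfRecord₁₃ F N θ₀ P.K (gOfRecord₁₃ F N θ₀ P) (i + 1) U = 0)
    (hres : ∀ k, k ≤ P.K → HRestrict F N εbg P.K k (dom k))
    (huniq : ∀ k, k ≤ P.K → ∀ V ∈ dom k, ∀ j < k, UniqueUkOrbit F N P.K (j + 1) εbg (Averaging.iter (avOfRecord F N P.K) (j + 1) (Uk F N P.K k εbg V)))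
    (hρ : 0 < ρ) (hρreg : ρ ≤ θ₀.ν.εreg) (hle : θ₀.ν.εreg ≤ εbg)
    (haxbg : ∀ k, k ≤ P.K → ∀ V ∈ dom k, ∀ j < k, AxialGauge (cd j) (Averaging.iter (avOfRecord F N P.K) j (Uk F N P.K k εbg V)))
    (haxDom : ∀ j < P.K, ∀ W ∈ dom (j + 1), AxialGauge (cd j) (critCfgOfRecord F N θ₀.ν P.K j W))
    (hρ3 : (143 * (((((F.P P.K).d + 4 : ℕ) : ℝ)) ^ 2 / 4) ^ 2) * ρ ≤ 1 / 3)
    (hρ2 : 2 * ρ ≤ 2 * deltaSU (Fin N) / ((((F.P P.K).d + 4) * (F.P P.K).L : ℕ) : ℝ) ^ 2) (hρ₀ : 2 * ρ ≤ θ₀.ν.ε₀ * ((F.P P.K).L : ℝ) ^ 2) :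
    ∀ k, k ≤ P.K → ∀ V ∈ dom k, ∀ j < k, Averaging.iter (avOfRecord F N P.K) j (Uk F N P.K k εbg V) ∈
      Nat.rec (motive := fun j => Set (GaugeField (F.P P.K) j (SU N))) Set.univ
        (fun i _ => regSetOfRecord F N P.K i (betaInputOfRecord F N (TβOfRecord₁₃ F N) (chiβOfRecord₁₃ F N θ₀) P.K (gOfRecord₁₃ F N θ₀ P) i) ∩ dom (i + 1)) j := by
  intro k hk V hV j hjk
  cases j with
  | zero => exact Set.mem_univ _
  | succ i => exact hnestU_of_suppU_of_hierAxial_of_memChar θ₀ hεχ P hdom cd hχregU hres huniq hρ hρreg hle haxbg haxDom hρ3 hρ2 hρ₀ k hk V hV i hjk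

end Summit.QuantumFields.YangMills.BalabanUVNodes.N09HeredNestingOnMembershipFamily

end
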